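import Summits.AnomalousDissipation.AnomalousDissipation.Theorems.TwoAndHalfDTwohalfdThesisStubGKFloorOfTailTools
import Summits.AnomalousDissipation.AnomalousDissipation.Theorems.TwoAndHalfDTwohalfdThesisStubGlobalRelease
import Summits.AnomalousDissipation.AnomalousDissipation.Theorems.TwoAndHalfDTwohalfdThesisStubSpinupShift

/-!
# J2 `stub_releasedMixingWitness_of_profileMixerRealizable`: the sibling crux's kernel S1' IMPLIES this line's kernel W

Junction stub J2 of the line `Sketch` (duhamel-release) for the crux
`Summit.AnomalousDissipation.AnomalousDissipation.Theses.TwoAndHalfD.TwohalfdThesis`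
(stmt-AnomalousDissipation-0206), lead c3.

Route `TwoAndHalfD` has two staffed crux lines with ONE open kernel each: W (`stub_releasedMixingWitness`,
this line) and S1' (`stub_profileMixerRealizable`, line `budgeted-mixer-template` of the sibling crux
`ScalarAnomalySteadySourceFormal`, stmt-AnomalousDissipation-0448).  S1' asks for ONE steady `(g, h)`, `ν_j → 0`,
classical planar NS with pointwise energy `≤ E`, an ANTITONE majorant `ρm ≥ 0` for the releases of `h` from
EVERY start time `s ≥ 0` on every window (`‖φ(t)‖² ≤ ρm(t-s)²‖h‖²`) with `∫₀ᵗ ρm ≤ R` and the tail clause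
`‖h‖² ∫_L^t ρm ≤ c₀/2` (`t ≥ L`), and a cold-start input floor at ONE lag `L > 0` from every start time:
`c₀ ≤ ⟪h, θ'(s+L)⟫` for the classical cold start `θ'` from `s`.  THIS FILE proves, verbatim on the registered
signatures, `S1' → W` (`stub_releasedMixingWitness_of_profileMixerRealizable`): so W is the WEAKER of the two
open kernels of the route (W ⇒ X ∧ #2 is landed, p96811; S1' ⇒ X is landed, p96358), and every no-go for W
(single shell G4, unforced H3, S6 ⇒ ¬W J1) is a no-go for S1'.

PROOF.  Take the SAME `(g, h, ν, v, p)`, the global classical releases `φ j s` of `h` (they exist over the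
smooth solenoidal drift, `exists_global_release`, p97021), `Λ := ρm`, `s₀ := 0`, `M := R`, `ε := c₀/2`.
Envelope: S1''s decay clause on the window `[s, t+1]`.  Integrability and `∫_{[0,∞)} ρm ≤ R`: antitone, `≥ 0`,
bounded partial integrals (`integrableOn_Ioi_of_intervalIntegral_norm_bounded`,
`intervalIntegral_tendsto_integral_Ioi`).  Green–Kubo floor: for `t ≥ L` split the Duhamel integral
`G(t) = ∫₀ᵗ ⟪h, φ j σ (t)⟫ dσ` (continuous in `σ`, `exists_continuousOn_releasePairing`) at `t - L`:
the OLD part is `≥ -‖h‖²∫_L^t ρm ≥ -c₀/2` (envelope + Cauchy–Schwarz, tail clause), the YOUNG part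
`∫_{t-L}^t ⟪h, φ j σ (t)⟫ dσ = ⟪h, θ'(t)⟫ ≥ c₀` is the cold-start pairing at lag `L` from `s = t - L` (weak
Duhamel D0 `stub_weakDuhamel`, p87403, for the system translated by `t - L` — `stub_spinupShift`, p96925 —
and S1''s floor clause applied to the translated-back cold start); so `G(t) ≥ c₀/2` for `t ≥ L`, `G` is locally
integrable and bounded by `R‖h‖²` (D1's splitting estimate), and the Cesàro bookkeeping
`le_liminf_timeMean_of_eventually_le` (H1-tools, p116589) gives `liminf ≥ c₀/2`.
Supports stmt-AnomalousDissipation-0206. [folklore]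
-/

noncomputable section

-- the summit path `AnomalousDissipation/AnomalousDissipation` duplicates a namespace component
set_option linter.dupNamespace false

namespace Summit.AnomalousDissipation.AnomalousDissipation.Theorems.TwohalfdThesis

open MeasureTheory Set Filter Topology
open scoped ENNReal NNReal InnerProductSpace
open Literature.Analysis.FunctionSpaces Literature.Analysis.FluidPDE

variable {d : Type*} [Fintype d] [DecidableEq d]

/-! ## Time translation of classical FORCED solutions -/

/-- **Time shift of classical forced solutions.** If `θ` solves `∂ₜθ + u·∇θ = κΔθ + src` classically on
`S × T^d`, then `σ ↦ θ (σ + c)` solves the equation with drift `σ ↦ u (σ + c)` and source `σ ↦ src (σ + c)`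
on `((· + c)⁻¹' S) × T^d` (twin of `isClassicalScalarTransportOn_comp_add_const`). [folklore] -/
theorem isClassicalScalarTransportForcedOn_comp_add_const {S : Set ℝ} {κ : ℝ}
    {u : ℝ → UnitAddTorus d → EuclideanSpace ℝ d} {src θ : ℝ → UnitAddTorus d → ℝ}
    (h : Torus.IsClassicalScalarTransportForcedOn S κ u src θ) (c : ℝ) :
    Torus.IsClassicalScalarTransportForcedOn ((· + c) ⁻¹' S) κ (fun σ => u (σ + c))
      (fun σ => src (σ + c)) (fun σ => θ (σ + c)) where
  smooth_velocity := h.smooth_velocity.comp_add_const c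
  smooth_source := h.smooth_source.comp_add_const c
  smooth_scalar := h.smooth_scalar.comp_add_const c
  transport σ hσ x := by
    rw [Torus.timeDerivWithin_comp_add_const]
    exact h.transport (σ + c) hσ x
  divFree σ hσ := h.divFree (σ + c) hσ

/-! ## Improper-integral bookkeeping for an antitone nonnegative majorant -/

omit [DecidableEq d] in
/-- An antitone `ρ ≥ 0` with `∫₀ᵗ ρ ≤ R` for all `t ≥ 0` is integrable on `[0, ∞)` with
`∫_{[0,∞)} ρ ≤ R`. [folklore] -/
theorem integrableOn_Ici_and_integral_le_of_antitone {ρ : ℝ → ℝ} {R : ℝ} (hanti : Antitone ρ)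
    (h0 : ∀ r, 0 ≤ ρ r) (hR : ∀ t, 0 ≤ t → ∫ r in (0 : ℝ)..t, ρ r ≤ R) :
    IntegrableOn ρ (Ici 0) ∧ ∫ r in Ici 0, ρ r ≤ R := by
  have hloc : ∀ t : ℝ, IntegrableOn ρ (Ioc 0 t) volume := fun t =>
    (hanti.intervalIntegrable (a := 0) (b := t)).1
  have hIoi : IntegrableOn ρ (Ioi 0) volume := by
    refine integrableOn_Ioi_of_intervalIntegral_norm_bounded R 0 (fun n : ℕ => hloc n)
      tendsto_natCast_atTop_atTop (Eventually.of_forall fun n => ?_)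
    have h1 : ∫ x in (0 : ℝ)..n, ‖ρ x‖ = ∫ x in (0 : ℝ)..n, ρ x :=
      intervalIntegral.integral_congr fun x _ => by rw [Real.norm_eq_abs, abs_of_nonneg (h0 x)]
    rw [h1]
    exact hR n (Nat.cast_nonneg n)
  have hIci : IntegrableOn ρ (Ici 0) := (integrableOn_Ici_iff_integrableOn_Ioi).2 hIoi
  refine ⟨hIci, ?_⟩
  rw [integral_Ici_eq_integral_Ioi]
  have ht := intervalIntegral_tendsto_integral_Ioi 0 hIoi tendsto_natCast_atTop_atTop
  exact le_of_tendsto' ht fun n => hR n (Nat.cast_nonneg n)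

/-! ## The young-age part of the Duhamel integral is a cold-start pairing -/

/-- **Young ages = cold start at lag `L`.**  Over a smooth solenoidal drift `v` on `[0, ∞)`, with the global
classical releases `φ s` of the smooth `h` (`s ≥ 0`) and `κ > 0`: for `0 ≤ c` and `0 < L` there is a classical
cold start `θ'` on `[c, c + L]` (`∂ₜθ' + v·∇θ' = κΔθ' + h`, `θ'(c) = 0`) with
`∫ h θ'(c + L) = ∫_c^{c+L} (∫ φ s (c + L) h) ds` — weak Duhamel for the system translated by `c`
(`stub_spinupShift`, `stub_weakDuhamel`) and translation back. [folklore] -/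
theorem exists_coldStart_window_eq_young_duhamel {κ c L : ℝ}
    {v : ℝ → UnitAddTorus (Fin 2) → EuclideanSpace ℝ (Fin 2)} {h : UnitAddTorus (Fin 2) → ℝ}
    {φ : ℝ → ℝ → UnitAddTorus (Fin 2) → ℝ} {g : UnitAddTorus (Fin 2) → EuclideanSpace ℝ (Fin 2)}
    {p : ℝ → UnitAddTorus (Fin 2) → ℝ} (hκ : 0 < κ) (hc : 0 ≤ c) (hL : 0 < L)
    (hNS : Torus.IsClassicalNSSolutionOn (Ici 0) κ (fun _ => g) v p) (hh : Torus.IsSmooth h)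
    (hφ : ∀ s, 0 ≤ s → Torus.IsClassicalScalarTransportOn (Ici s) κ v (φ s) ∧ φ s s = h) :
    ∃ θ' : ℝ → UnitAddTorus (Fin 2) → ℝ,
      Torus.IsClassicalScalarTransportForcedOn (Icc c (c + L)) κ v (fun _ => h) θ' ∧
        θ' c = (fun _ => (0 : ℝ)) ∧
        ∫ x, h x * θ' (c + L) x = ∫ s in c..(c + L), ∫ x, φ s (c + L) x * h x := by
  -- the translated system
  obtain ⟨hNS', hφ'⟩ := stub_spinupShift κ c g h v p φ hc hNS hφ
  have hu' : Torus.IsSmoothSpaceTimeOn (Ici 0) (fun t => v (t + c)) := hNS'.smooth_velocity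
  have hdiv' : ∀ t ∈ Ici (0 : ℝ), Torus.IsDivFree ((fun t => v (t + c)) t) := hNS'.divFree
  obtain ⟨θ'', hθ'', hθ''0⟩ :=
    ScalarAnomalySteadySourceFormal.ColdStartVariance.exists_global_coldStart hκ hu' hdiv' hh
  have hD0 := stub_weakDuhamel κ (fun t => v (t + c)) h θ'' (fun s t => φ (s + c) (t + c)) hκ hh hθ''
    hθ''0 hφ' h hh L hL.le
  -- translate the cold start back to `[c, c + L]`
  have hback := isClassicalScalarTransportForcedOn_comp_add_const hθ'' (-c)
  rw [Set.preimage_add_const_Ici, sub_neg_eq_add, zero_add] at hback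
  have hback' : Torus.IsClassicalScalarTransportForcedOn (Ici c) κ v (fun _ => h)
      (fun σ => θ'' (σ + -c)) := by
    have e1 : (fun σ => (fun t => v (t + c)) (σ + -c)) = v := by
      funext σ; simp only [neg_add_cancel_right]
    rw [e1] at hback
    exact hback
  refine ⟨fun σ => θ'' (σ + -c), ?_, ?_, ?_⟩
  · exact ScalarAnomalySteadySourceFormal.ColdStartVariance.forced_restrict hback' Icc_subset_Ici_self
      (uniqueDiffOn_Icc (by linarith))
  · show θ'' (c + -c) = fun _ => 0
    rw [add_neg_cancel]; exact hθ''0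
  · show ∫ x, h x * θ'' (c + L + -c) x = ∫ s in c..(c + L), ∫ x, φ s (c + L) x * h x
    rw [show c + L + -c = L by ring]
    have e2 : ∫ x, h x * θ'' L x = ∫ x, θ'' L x * h x :=
      integral_congr_ae (Eventually.of_forall fun x => mul_comm _ _)
    rw [e2, hD0]
    -- change of variables `s = s' + c`
    have e3 := intervalIntegral.integral_comp_add_right (a := 0) (b := L)
      (fun s => ∫ x, φ s (c + L) x * h x) c
    simp only [zero_add] at e3
    simp only [add_comm L c]
    rw [e3, add_comm L c]

/-! ## The stub: S1' ⇒ W -/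

/-- **J2 `stub_releasedMixingWitness_of_profileMixerRealizable` (line `Sketch` = duhamel-release, crux
`TwoAndHalfD.TwohalfdThesis`; registered signature): the sibling crux's kernel S1'
(`stub_profileMixerRealizable` of stmt-0448, verbatim) IMPLIES this line's kernel W (`stub_releasedMixingWitness`,
verbatim).**  Witness of W: the same planar family, the global releases of `h`, `Λ = ρm`, `s₀ = 0`, `M = R`,
`ε = c₀/2`; the Green–Kubo floor from the tail clause (old ages) and the cold-start floor at lag `L` (young ages,
weak Duhamel for the translated system). [folklore] -/
theorem stub_releasedMixingWitness_of_profileMixerRealizable :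
    (∃ (g : UnitAddTorus (Fin 2) → EuclideanSpace ℝ (Fin 2)) (h : UnitAddTorus (Fin 2) → ℝ),
      Torus.IsSmooth g ∧ Torus.IsDivFree g ∧ Torus.HasZeroMean g ∧ Torus.IsSmooth h ∧ Torus.HasZeroMean h ∧
      ∃ (ν : ℕ → ℝ) (v : ℕ → ℝ → UnitAddTorus (Fin 2) → EuclideanSpace ℝ (Fin 2))
        (p : ℕ → ℝ → UnitAddTorus (Fin 2) → ℝ) (ρm : ℝ → ℝ) (E R L c₀ : ℝ),
        (∀ j, 0 < ν j) ∧ Tendsto ν atTop (𝓝 0) ∧ 0 < L ∧ 0 < c₀ ∧ Antitone ρm ∧ (∀ r, 0 ≤ ρm r) ∧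
        (∀ t, 0 ≤ t → ∫ r in (0 : ℝ)..t, ρm r ≤ R) ∧
        (∀ t, L ≤ t → Torus.scalarL2Sq h * ∫ r in L..t, ρm r ≤ c₀ / 2) ∧
        (∀ j, Torus.IsClassicalNSSolutionOn (Set.Ici 0) (ν j) (fun _ => g) (v j) (p j)) ∧
        (∀ j t, 0 ≤ t → ∫ x, ‖v j t x‖ ^ 2 ≤ E) ∧
        (∀ j (s T' : ℝ), 0 ≤ s → ∀ φ : ℝ → UnitAddTorus (Fin 2) → ℝ,
          Torus.IsClassicalScalarTransportOn (Set.Icc s T') (ν j) (v j) φ → φ s = h →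
          ∀ t ∈ Set.Icc s T', Torus.scalarL2Sq (φ t) ≤ ρm (t - s) ^ 2 * Torus.scalarL2Sq h) ∧
        (∀ j (s : ℝ), 0 ≤ s → ∀ θ' : ℝ → UnitAddTorus (Fin 2) → ℝ,
          Torus.IsClassicalScalarTransportForcedOn (Set.Icc s (s + L)) (ν j) (v j) (fun _ => h) θ' →
          θ' s = (fun _ => (0 : ℝ)) → c₀ ≤ ∫ x, h x * θ' (s + L) x)) →
    ∃ (g : (UnitAddTorus (Fin 2)) → (EuclideanSpace ℝ (Fin 2))) (h : (UnitAddTorus (Fin 2)) → ℝ),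
      Torus.IsSmooth g ∧ Torus.IsDivFree g ∧ Torus.HasZeroMean g ∧ Torus.IsSmooth h ∧ Torus.HasZeroMean h ∧
      ∃ (ν : ℕ → ℝ) (v : ℕ → ℝ → (UnitAddTorus (Fin 2)) → (EuclideanSpace ℝ (Fin 2)))
        (p : ℕ → ℝ → (UnitAddTorus (Fin 2)) → ℝ) (φ : ℕ → ℝ → ℝ → (UnitAddTorus (Fin 2)) → ℝ)
        (Λ : ℝ → ℝ) (E s₀ M ε : ℝ),
        (∀ j, 0 < ν j) ∧ Tendsto ν atTop (𝓝 0) ∧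
        (∀ j, Torus.IsClassicalNSSolutionOn (Ici 0) (ν j) (fun _ => g) (v j) (p j)) ∧
        (∀ j t, 0 ≤ t → ∫ x, ‖v j t x‖ ^ 2 ≤ E) ∧
        (∀ j s, 0 ≤ s → Torus.IsClassicalScalarTransportOn (Ici s) (ν j) (v j) (φ j s) ∧ φ j s s = h) ∧
        0 ≤ s₀ ∧ (∀ τ, 0 ≤ Λ τ) ∧ IntegrableOn Λ (Ici 0) ∧ (∫ τ in Ici 0, Λ τ) ≤ M ∧
        (∀ j s t, s₀ ≤ s → s ≤ t → Torus.scalarL2Sq (φ j s t) ≤ Λ (t - s) ^ 2 * Torus.scalarL2Sq h) ∧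
        0 < ε ∧
        (∀ j, ε ≤ liminf (timeMean fun t => ∫ s in (0 : ℝ)..t, ∫ x, h x * φ j s t x) atTop) := by
  rintro ⟨g, h, hgs, hgd, hgz, hhs, hhz, ν, v, p, ρm, E, R, L, c₀, hν, hν0, hL, hc₀, hanti, hρ0, hρR,
    hρtail, hNS, hE, hdecay, hfloor⟩
  -- global classical releases of `h` over each drift
  have hu : ∀ j, Torus.IsSmoothSpaceTimeOn (Ici 0) (v j) := fun j => (hNS j).smooth_velocity
  have hdiv : ∀ j, ∀ t ∈ Ici (0 : ℝ), Torus.IsDivFree (v j t) := fun j => (hNS j).divFree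
  have hrelE : ∀ (j : ℕ) (s : ℝ), ∃ φ : ℝ → UnitAddTorus (Fin 2) → ℝ,
      0 ≤ s → Torus.IsClassicalScalarTransportOn (Ici s) (ν j) (v j) φ ∧ φ s = h := by
    intro j s
    by_cases hs : 0 ≤ s
    · obtain ⟨φ, hφ⟩ := exists_global_release (hν j) (hu j) (hdiv j) hs hhs
      exact ⟨φ, fun _ => hφ⟩
    · exact ⟨fun _ _ => 0, fun h' => absurd h' hs⟩
  choose φ hφ using hrelE
  obtain ⟨hρi, hρM⟩ := integrableOn_Ici_and_integral_le_of_antitone hanti hρ0 hρR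
  set N : ℝ := Torus.scalarL2Sq h with hN_def
  have hN : 0 ≤ N := Torus.scalarL2Sq_nonneg h
  -- the envelope of W from S1''s decay clause
  have henv : ∀ j s t, 0 ≤ s → s ≤ t → Torus.scalarL2Sq (φ j s t) ≤ ρm (t - s) ^ 2 * Torus.scalarL2Sq h := by
    intro j s t hs hst
    have hwin : Torus.IsClassicalScalarTransportOn (Set.Icc s (t + 1)) (ν j) (v j) (φ j s) :=
      (hφ j s hs).1.restrict_Icc (by linarith) Icc_subset_Ici_self
    exact hdecay j s (t + 1) hs (φ j s) hwin (hφ j s hs).2 t ⟨hst, by linarith⟩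
  refine ⟨g, h, hgs, hgd, hgz, hhs, hhz, ν, v, p, φ, ρm, E, 0, R, c₀ / 2, hν, hν0, hNS, hE,
    fun j s hs => hφ j s hs, le_rfl, hρ0, hρi, hρM, fun j s t hs hst => henv j s t hs hst,
    half_pos hc₀, fun j => ?_⟩
  -- the Green–Kubo floor for the member `j`
  set G : ℝ → ℝ := fun t => ∫ s in (0 : ℝ)..t, ∫ x, h x * φ j s t x with hG_def
  have hφj : ∀ s, 0 ≤ s → Torus.IsClassicalScalarTransportOn (Ici s) (ν j) (v j) (φ j s) ∧ φ j s s = h :=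
    fun s hs => hφ j s hs
  -- (a) local integrability of `G` through the cold start from `0` (weak Duhamel)
  obtain ⟨θ, hθ, hθ0⟩ :=
    ScalarAnomalySteadySourceFormal.ColdStartVariance.exists_global_coldStart (hν j) (hu j) (hdiv j) hhs
  have hGθ : ∀ t, 0 ≤ t → G t = ∫ x, θ t x * h x := by
    intro t ht
    rw [stub_weakDuhamel (ν j) (v j) h θ (φ j) (hν j) hhs hθ hθ0 hφj h hhs t ht, hG_def]
    refine intervalIntegral.integral_congr fun s _ => ?_
    exact integral_congr_ae (Eventually.of_forall fun x => mul_comm _ _)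
  have hQc : ContinuousOn (fun t => ∫ x, θ t x * h x) (Ici 0) :=
    (hθ.smooth_scalar.mul (Torus.isSmoothSpaceTimeOn_const hhs _)).continuousOn_integral (convex_Ici 0)
  have hGi : ∀ T, 0 ≤ T → IntervalIntegrable G volume 0 T := by
    intro T hT
    have h1 : ContinuousOn (fun t => ∫ x, θ t x * h x) (uIcc 0 T) :=
      hQc.mono (by rw [uIcc_of_le hT]; exact Icc_subset_Ici_self)
    refine h1.intervalIntegrable.congr ?_
    intro t ht
    rw [uIoc_of_le hT] at ht
    exact (hGθ t ht.1.le).symm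
  -- (b) `|G t| ≤ R N`
  have hGb : ∀ t, 0 < t → |G t| ≤ R * N := by
    intro t ht
    have hF1 : ∀ s, 0 < s → s ≤ t → |∫ x, h x * φ j s t x| ≤ Real.sqrt N * Real.sqrt N := by
      intro s hs hst
      rw [Real.mul_self_sqrt hN]
      exact abs_releasePairing_le (hν j).le hhs (hφj s hs.le).1 (hφj s hs.le).2 hst
    have hF2 : ∀ s, 0 < s → (0 : ℝ) < s → s ≤ t →
        |∫ x, h x * φ j s t x| ≤ ρm (t - s) * Real.sqrt N * Real.sqrt N := by
      intro s hs _ hst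
      rw [mul_assoc, Real.mul_self_sqrt hN]
      exact abs_releasePairing_le_of_envelope hhs
        ((hφj s hs.le).1.smooth_scalar.isSmooth_slice (show t ∈ Ici s from hst)) (hρ0 _)
        (henv j s t hs.le hst)
    have hup := integral_le_of_release_envelope (Real.sqrt_nonneg N) (Real.sqrt_nonneg N) le_rfl ht.le
      hρ0 hρi hρM hF1 hF2
    have hF1' : ∀ s, 0 < s → s ≤ t → |-(∫ x, h x * φ j s t x)| ≤ Real.sqrt N * Real.sqrt N :=
      fun s hs hst => by rw [abs_neg]; exact hF1 s hs hst
    have hF2' : ∀ s, 0 < s → (0 : ℝ) < s → s ≤ t →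
        |-(∫ x, h x * φ j s t x)| ≤ ρm (t - s) * Real.sqrt N * Real.sqrt N :=
      fun s hs hs' hst => by rw [abs_neg]; exact hF2 s hs hs' hst
    have hlow := integral_le_of_release_envelope (Real.sqrt_nonneg N) (Real.sqrt_nonneg N) le_rfl ht.le
      hρ0 hρi hρM hF1' hF2'
    rw [intervalIntegral.integral_neg] at hlow
    rw [zero_add, mul_assoc, Real.mul_self_sqrt hN] at hup hlow
    have hlow' : -(G t) ≤ R * N := by simpa [hG_def] using hlow
    have hup' : G t ≤ R * N := by simpa [hG_def] using hup
    exact abs_le.2 ⟨neg_le.1 hlow', hup'⟩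
  -- (c) `G t ≥ c₀/2` for `t ≥ L`
  have hev : ∀ δ, 0 < δ → ∃ T₁, 0 ≤ T₁ ∧ ∀ t, T₁ ≤ t → c₀ / 2 - δ ≤ G t := by
    intro δ hδ
    refine ⟨L, hL.le, fun t ht => ?_⟩
    have htpos : 0 < t := hL.trans_le ht
    have hc : 0 ≤ t - L := by linarith
    obtain ⟨D, hDc, hD⟩ := exists_continuousOn_releasePairing (hν j) htpos hhs hφj
    have hcongr : G t = ∫ s in (0 : ℝ)..t, D s :=
      intervalIntegral.integral_congr fun s hs => hD s (by rwa [uIcc_of_le htpos.le] at hs)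
    have hDi : ∀ a b, 0 ≤ a → a ≤ b → b ≤ t → IntervalIntegrable D volume a b := fun a b ha hab hb =>
      (hDc.mono (by rw [uIcc_of_le hab]; exact Icc_subset_Icc ha hb)).intervalIntegrable
    -- old ages: `|∫₀^{t-L} D| ≤ N ∫_L^t ρm ≤ c₀/2`
    have hold : -(c₀ / 2) ≤ ∫ s in (0 : ℝ)..(t - L), D s := by
      have hint : IntervalIntegrable (fun s => ρm (t - s) * N) volume 0 (t - L) :=
        ((intervalIntegrable_comp_sub_left_of_integrableOn hρi htpos.le).mul_const N).mono_set (by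
          rw [uIcc_of_le hc, uIcc_of_le htpos.le]; exact Icc_subset_Icc le_rfl (by linarith))
      have h1 : ‖∫ s in (0 : ℝ)..(t - L), D s‖ ≤ ∫ s in (0 : ℝ)..(t - L), ρm (t - s) * N :=
        intervalIntegral.norm_integral_le_of_norm_le hc (ae_of_all _ fun s hs => by
          rw [Real.norm_eq_abs, ← hD s ⟨hs.1.le, by linarith [hs.2]⟩]
          exact abs_releasePairing_le_of_envelope hhs
            ((hφj s hs.1.le).1.smooth_scalar.isSmooth_slice (show t ∈ Ici s by
              simp only [mem_Ici]; linarith [hs.2]))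
            (hρ0 _) (henv j s t hs.1.le (by linarith [hs.2]))) hint
      have h2 : ∫ s in (0 : ℝ)..(t - L), ρm (t - s) * N ≤ c₀ / 2 := by
        rw [intervalIntegral.integral_mul_const, mul_comm _ N, intervalIntegral.integral_comp_sub_left ρm t,
          sub_sub_cancel, sub_zero]
        exact hρtail t ht
      rw [Real.norm_eq_abs] at h1
      have := (abs_le.1 (h1.trans h2)).1
      linarith
    -- young ages: `∫_{t-L}^t D = ⟪h, θ'(t)⟫ ≥ c₀`
    have hyoung : c₀ ≤ ∫ s in (t - L)..t, D s := by
      obtain ⟨θ', hθ', hθ'0, hθ'eq⟩ :=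
        exists_coldStart_window_eq_young_duhamel (hν j) hc hL (hNS j) hhs hφj
      have hfl := hfloor j (t - L) hc θ' hθ' hθ'0
      rw [sub_add_cancel] at hfl hθ'eq
      rw [hθ'eq] at hfl
      refine hfl.trans (le_of_eq ?_)
      refine intervalIntegral.integral_congr fun s hs => ?_
      rw [uIcc_of_le (by linarith : t - L ≤ t)] at hs
      rw [← hD s ⟨hc.trans hs.1, hs.2⟩]
      exact integral_congr_ae (Eventually.of_forall fun x => mul_comm _ _)
    -- sum up
    rw [hcongr, ← intervalIntegral.integral_add_adjacent_intervals (hDi 0 (t - L) le_rfl hc (by linarith))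
      (hDi (t - L) t hc (by linarith) le_rfl)]
    linarith
  exact le_liminf_timeMean_of_eventually_le hGi hGb hev

end Summit.AnomalousDissipation.AnomalousDissipation.Theorems.TwohalfdThesis

end
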